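import Literature.MathematicalPhysics.QuantumFieldTheory.Balaban1983to89.B9Thm314GpFlatTorusGeometry

/-!
# `Balaban1983to89.B9Thm314GpFlatOmegaOff` — [Balaban1985BackgroundPropagators] (3.154) p. 427 on the tree's two-family torus model
# (`B9Thm314GpFlatTorusGeometry`): OFF THE RESTRICTION «y, y′ ∈ Ω^{(k)}» the distance d(y, y′, Ω) is dominated by the multiscale distance d(y, y′) —
# the located geometric input (γ) of `B9Thm314Unrestricted.thm314Printed_of_supOn` HOLDS in this model with `r = 0`

B9 = T. Bałaban, *Propagators for lattice gauge theories in a background field*, Commun. Math. Phys. **99** (1985) 389–434 [Balaban1985BackgroundPropagators],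
(3.154) p. 427 [PDF 39]: *"d(y, y′, Ω) = inf_{y₁∈Ωᶜ∩T^{(k)}}(|y − y₁| + |y₁ − y′|)"*, p. 426: *"Let us take localizations determined by points y, y′ ∈ Ω^{(k)}"*.
[B6] = [Balaban1984PropagatorsII] (2.46) p. 231 (the multiscale distance).

CONTEXT (DAG node N06, seat `pub-ymgap-dag-n06-a`; typed-leaf flag t314, part (i)).  `B9Thm314Unrestricted.thm314Printed_of_supOn` (p410665) derives the
unrestricted reading `B9.Thm314Printed` from the printed restricted one given (β) a plain difference bound and (γ) «off the restriction, d(y, y′, Ω) ≤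
d(y, y′) + r».  THIS FILE PROVES (γ) IN THE TREE'S ONLY MODEL OF (3.154) — the two nested torus families `D, D′` of `B9Thm314GpFlatTorusGeometry` (U = 1,
lattice units; `Ω = Ω_k ∩ Ω′_k` read on k-blocks, `Ωᶜ ∩ T^{(k)}` = `OmegaC D D′`, `|·|` on `T^{(k)}` = `tdistK`, d(y, y′, Ω) = `dOmega D D′`): for top blocks
`y, q` of `{Ω_j}` (localisations of G′[D]), if the k-block of `y` OR of `q` lies outside `Ω` (its label is in `OmegaC D D′` — for a top block this is
«`y ∉ Ω^{(k)}`», `mem_OmegaC_iff_of_blk_eq`), then `d(y, q, Ω) ≤ d_D(y, q)` (take `y₁ :=` that label in (3.154); `|y − y₁| = 0`, `|y₁ − q| ≤ d_D(y, q)` by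
`dist_posT_le_mul_distT`) — i.e. (γ) with `r = 0` and `OmK y :=` «the k-block of y lies in Ω».

WHAT IS PROVED (kernel; no `sorry`; bookkeeping over the model's definitions): `tdistK_self`, `tdistK_le_distT_of_top` (`|y − q|` in units of `L^k` is
at most `d_D(y, q)` for top blocks), `dOmega_le_distT_of_mem_OmegaC_left ∕ _right`, `dOmega_le_distT_off` (the (γ)-shape: `¬(y ∈ Ω ∧ q ∈ Ω) ⇒ d(y,q,Ω) ≤ d_D(y,q)`).
HONEST SCOPE: the flat model only (U = 1, top blocks of one family, lattice units); nothing of [B9] asserted; count-neutral; NOT continuum ∕ Clay.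
-/

namespace Literature.MathematicalPhysics.QuantumFieldTheory.Balaban1983to89.B9Thm314GpFlatOmegaOff

open Finset
open Literature.MathematicalPhysics.QuantumFieldTheory.Balaban1983to89.B6MultiLevelBoxOperator
open Literature.MathematicalPhysics.QuantumFieldTheory.Balaban1983to89.B6MultiLevelTorusOperator
open Literature.MathematicalPhysics.QuantumFieldTheory.Balaban1983to89.B6Geom246MultiLevelBox
open Literature.MathematicalPhysics.QuantumFieldTheory.Balaban1983to89.B6Geom246MultiLevelTorus
open Literature.MathematicalPhysics.QuantumFieldTheory.Balaban1983to89.B9Thm314GpFlatTorusGeometry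

noncomputable section

variable {d : ℕ} {ℓ Mh k R : ℕ} {P : Fin (d + 1) → ℕ} (D D' : TDomains d ℓ Mh k P R)

omit D D' in
/-- `|y − y| = 0` on `T^{(k)}`. [cite: Balaban1985BackgroundPropagators, (3.154) p.427, dictionary] -/
theorem tdistK_self (β : Fin (d + 1) → ℤ) : tdistK (ℓ := ℓ) (Mh := Mh) (k := k) (P := P) β β = 0 := by
  unfold tdistK
  rw [dist_self, zero_div]

omit D' in
/-- **`|y − q| ≤ d_D(y, q)`** for TOP blocks `y, q` of `{Ω_j}` (positions = k-block centres, `posT_eq_of_top`; torus distance at most `L^k` times the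
multiscale distance, `dist_posT_le_mul_distT`; `tdistK` is measured in units of `L^k`). [cite: Balaban1984PropagatorsII, (2.46) p.231; Balaban1985BackgroundPropagators, (3.154) p.427 (dictionary)] -/
theorem tdistK_le_distT_of_top (hMh : 1 ≤ Mh) (hP : ∀ μ, 1 ≤ P μ) {y q : ↥(bset D.toDomains)} (hy : y.1.1 = k) (hq : q.1.1 = k) :
    tdistK (ℓ := ℓ) (Mh := Mh) (k := k) (P := P) y.1.2 q.1.2 ≤ (geomT D).dist y q := by
  have hLk : (0 : ℝ) < (((ℓ + 1) ^ k : ℕ) : ℝ) := by exact_mod_cast Nat.pos_of_ne_zero (pow_ne_zero _ (Nat.succ_ne_zero ℓ))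
  unfold tdistK
  rw [← posT_eq_of_top D hy, ← posT_eq_of_top D hq, div_le_iff₀ hLk]
  exact dist_posT_le_mul_distT D hMh hP y q

/-- If the k-block of `y` lies OUTSIDE `Ω` (its label is in `Ωᶜ ∩ T^{(k)}`), then `d(y, q, Ω) ≤ d_D(y, q)`: take `y₁ :=` that label in (3.154).
[cite: Balaban1985BackgroundPropagators, (3.154) p.427 (bookkeeping on the model)] -/
theorem dOmega_le_distT_of_mem_OmegaC_left (hMh : 1 ≤ Mh) (hP : ∀ μ, 1 ≤ P μ) {y q : ↥(bset D.toDomains)} (hy : y.1.1 = k)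
    (hq : q.1.1 = k) (h : y.1.2 ∈ OmegaC D D') : dOmega D D' y.1.2 q.1.2 ≤ (geomT D).dist y q := by
  refine (dOmega_le D D' h).trans ?_
  rw [tdistK_self, zero_add]
  exact tdistK_le_distT_of_top D hMh hP hy hq

/-- If the k-block of `q` lies OUTSIDE `Ω`, then `d(y, q, Ω) ≤ d_D(y, q)`: take `y₁ :=` the label of `q`. [cite: Balaban1985BackgroundPropagators, (3.154) p.427 (bookkeeping on the model)] -/
theorem dOmega_le_distT_of_mem_OmegaC_right (hMh : 1 ≤ Mh) (hP : ∀ μ, 1 ≤ P μ) {y q : ↥(bset D.toDomains)} (hy : y.1.1 = k)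
    (hq : q.1.1 = k) (h : q.1.2 ∈ OmegaC D D') : dOmega D D' y.1.2 q.1.2 ≤ (geomT D).dist y q := by
  refine (dOmega_le D D' h).trans ?_
  rw [tdistK_self, add_zero]
  exact tdistK_le_distT_of_top D hMh hP hy hq

/-- **(γ) of `B9Thm314Unrestricted.thm314Printed_of_supOn` on the model, with `r = 0`**: for top blocks `y, q` of `{Ω_j}` NOT BOTH inside `Ω`
(`OmK y :=` «the label of y is not in `Ωᶜ ∩ T^{(k)}`»), `d(y, q, Ω) ≤ d_D(y, q)`. [cite: Balaban1985BackgroundPropagators, Thm 3.14 (3.154) pp.426–427 (bookkeeping on the model)] -/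
theorem dOmega_le_distT_off (hMh : 1 ≤ Mh) (hP : ∀ μ, 1 ≤ P μ) {y q : ↥(bset D.toDomains)} (hy : y.1.1 = k) (hq : q.1.1 = k)
    (h : ¬ (y.1.2 ∉ OmegaC D D' ∧ q.1.2 ∉ OmegaC D D')) : dOmega D D' y.1.2 q.1.2 ≤ (geomT D).dist y q + 0 := by
  rw [add_zero]
  by_cases hyΩ : y.1.2 ∈ OmegaC D D'
  · exact dOmega_le_distT_of_mem_OmegaC_left D D' hMh hP hy hq hyΩ
  · have hqΩ : q.1.2 ∈ OmegaC D D' := by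
      by_contra hqΩ
      exact h ⟨hyΩ, hqΩ⟩
    exact dOmega_le_distT_of_mem_OmegaC_right D D' hMh hP hy hq hqΩ

end

end Literature.MathematicalPhysics.QuantumFieldTheory.Balaban1983to89.B9Thm314GpFlatOmegaOff
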